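import Mathlib
import Literature.Combinatorics.Enumerative.EntropyBregman

/-!
# Stub `stub_chainGibbs` (crux stmt-MatrixMultiplication-8303, line bregman-entropy-window)

Crux `Summit.MatrixMultiplication.MatrixMultiplication.Theses.SnSubsetDichotomy.GlobalBranch`, line
`bregman-entropy-window` (lead's skeleton `Cruxes/GlobalBranch/Lines/bregman_entropy_window.lean`),
registered stub `stub_chainGibbs`: the random-order CHAIN RULE with GIBBS' inequality for the uniform
measure on a nonempty `X ⊆ S_n` — with `N = #X`, `c i j = #{σ ∈ X : σ i = j}`,
`H_i = ∑_j negMulLog (c i j / N)`: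

  `n!·N·log N ≤ n!·N·∑_i H_i + ∑_i ∑_{σ ∈ X} ∑_τ log (∑_{i' : τ⁻¹ i ≤ τ⁻¹ i'} c i (σ i') / N)`,

the first half of the entropy Brégman / Cuckler–Kahn inequality.  It is the `Fin n` statement of the
Literature theorem
`Literature.Combinatorics.Enumerative.factorial_mul_card_mul_log_card_le_entropy_add_log_avail`
(`EntropyBregman.lean`, assembled from the landed stubs `stub_gibbsStep` = `EntropyBregmanGibbsStep.lean`
and `stub_chainTelescope` = `EntropyBregmanChainRule.lean`).
-/

set_option linter.dupNamespace false

namespace Summit.MatrixMultiplication.MatrixMultiplication.Theorems.GlobalBranch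

open scoped BigOperators Classical

/-- **Stub `stub_chainGibbs` — chain rule + Gibbs, averaged over all orders.**  For a nonempty finite
set `X` of permutations of `Fin n` (`N = #X`, `c i j = #{σ ∈ X : σ i = j}`):
`n!·N·log N ≤ n!·N·∑_i ∑_j negMulLog (c i j / N) + ∑_i ∑_{σ∈X} ∑_τ log (∑_{i' : τ⁻¹ i ≤ τ⁻¹ i'} c i (σ i')/N)`
— `H(σ) ≤ ∑_i H(σ i) + ∑_i 𝔼 log (available mass)` for `σ` uniform on `X`; the `Fin n` instance of
`Literature.Combinatorics.Enumerative.factorial_mul_card_mul_log_card_le_entropy_add_log_avail`.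
[cite: CucklerKahn2009, §2 (bipartite case)] -/
theorem stub_chainGibbs : ∀ (n : ℕ) (X : Finset (Equiv.Perm (Fin n))), X.Nonempty →
    ((n.factorial : ℝ) * (X.card : ℝ)) * Real.log (X.card : ℝ) ≤
      ((n.factorial : ℝ) * (X.card : ℝ)) *
          ∑ i : Fin n, ∑ j : Fin n,
            Real.negMulLog (((X.filter (fun σ => σ i = j)).card : ℝ) / (X.card : ℝ)) +
        ∑ i : Fin n, ∑ σ ∈ X, ∑ τ : Equiv.Perm (Fin n),
          Real.log (∑ i' ∈ Finset.univ.filter (fun i' => τ.symm i ≤ τ.symm i'),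
            ((X.filter (fun σ' => σ' i = σ i')).card : ℝ) / (X.card : ℝ)) := by
  intro n X hX
  convert Literature.Combinatorics.Enumerative.factorial_mul_card_mul_log_card_le_entropy_add_log_avail
    X hX using 7

end Summit.MatrixMultiplication.MatrixMultiplication.Theorems.GlobalBranch
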